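import Summits.AtomisticToContinuum.Crystallization.Theorems.ChartedZeroExcessLayeredLatticeLiouvilleZF
import Summits.AtomisticToContinuum.Crystallization.Theorems.ChartedZeroExcessLayeredLatticeLiouvilleZH

/-!
# (B′.5-J) rider ZZP — THE Θ-JUNCTION, pointwise: (GL) ⟸ X_Θ ∧ LEMMA C (critic row 1476 (B): ACCEPTED TO TYPE)

Lineage `stmt-AtomisticToContinuum-26636` (route ChartedPlanarOrder), lens-2 g81, PLAN l.7458 (B).  Imports tree ZF (`shell_bondLabel`) and tree ZH
(`BarlowAdj`, `IsBarlowBondChart`) ONLY.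

SETTING.  `S` a door set (`IsDoorSetP aHi δ S`, `aHi ≤ 1`), `K` the container, `C = placedCrystal L′ w′ U t` a cool shadow crystal
(`IsCoolShadowCrystal σ ϑr Rs ε r rI ℓ S K H L′ w′ U t`: `σ`-separated, REG-out on the cool zone `r < d(·, K)`, REG-in on the zone `rI < d(·, K)`),
`Ψ, τS` the global Barlow bond chart of `S` (tree ZV), `Φ, τC, D` LEMMA C's exact Barlow bond chart of `C` on an index region `D` which is
LINK-CLOSED within `Rl` of `K` (`hlc`: a chart site whose atom is within `Rl` of `K` has all its Barlow neighbours in `D`), and the cone-pin programme's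
output `X_Θ`: a lattice map `Θ`, INJECTIVE, carrying S-adjacency at sites of the sheets `Kread` to C-adjacency (`hiso`, forward direction only — the
backward direction of X_Θ is consumed on the PRODUCTION side, by the pin step ZZQ), and PARTNERED on the collar: every moat atom within `RΘ` of `K` has
`Θ y ∈ D` and `dist (Ψ y) (Φ (Θ y)) ≤ ε` (`hpart`).  `hK`: every inner site (`d(Ψ x, K) ≤ r`) lies in a sheet of `Kread`.  FINITENESS SOURCE, named:
`hfin : Set.Finite {x | ∃ k ∈ K, dist (Ψ x) k ≤ r}` (the inner index set; at assembly time: `K` bounded, `S` separated, `Ψ` injective).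

★★★ `exists_isBondLabel_of_slabIso`: then a bond label `IsBondLabel ε r ℓ S K C lab` exists — `lab = lab₀` (tree ZF `shell_bondLabel`, the REG-out
partner) on the moat, `lab p = Φ (Θ x)` on inner atoms `p = Ψ x`.  DIALS: `r + 28/25 + ε ≤ rI`, `rI + 28/25 + ε < RΘ ≤ ℓ`, `rI < Rl`, `2ε < σ`,
`0 ≤ ε ≤ 1/40`.  ★★★ `exists_isBondLabel_of_slabIso_record`: the (GL) record dials `(σ, ϑr, Rs, ε, r, rI, ℓ) = (17/20, 10⁻⁴, 5, 10⁻⁴, 8, 10, 43/2)`,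
`RΘ = 19.3`, with X_Θ's three clauses VERBATIM (PLAN l.7458) as binders.

PROOF (no pinning datum, no η-linearity, no (L2-C⟂′∥)/(L2-H); the C-bond length bound used is `IsBond`'s `28/25` through the exactness of `hΦ`):
DRIFT CONTROL `innerQ` — every inner site `x` has `Θ x ∈ D` and `d(Φ (Θ x), K) ≤ rI`: walk the in-sheet lattice line `sheetLine x n = (x.1, x.2 + n·(1,0))`
to its FIRST non-inner site (exists by `hfin`; it is S-bonded to an inner site, so within `r + 28/25 < RΘ` of `K`: a partnered moat site, whose Θ-label is
within `r + 28/25 + ε ≤ rI` of `K` — `base`), then backward along the line (`step`): S-adjacent ⇒ C-adjacent (`hiso`, the inner end is in a `Kread` sheet)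
⇒ in `D` (link-closure at the known end, `d ≤ rI < Rl`) ⇒ C-bonded (`hΦ`), so `d(Φ (Θ x_j), K) ≤ rI + 28/25`; and the REG-in BAND EXCLUSION: were
`d(Φ (Θ x_j), K) > rI`, REG-in would give an S-atom `p = Ψ y″` within `ε`, a moat atom (`d > rI − ε ≥ r`) within `rI + 28/25 + ε < RΘ` of `K`, hence
partnered, and `Φ (Θ y″) = Φ (Θ x_j)` (`σ`-separation, `2ε < σ`) ⇒ `y″ = x_j` (injectivity on `D`, `Θ` injective) — but `x_j` is inner (`d ≤ r`) and
`p` is not.  LABEL (tree ZK / pilot ZZE-1 shape with `(pinning datum, η-chart)` REPLACED by `Θ`): moat–moat clauses = `shell_bondLabel`; inner–inner bonds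
and collisions = `hiso` + exactness / injectivity on `D` + `Θ` injective; inner–moat: the moat end is within `r + 28/25 < RΘ` (bond) resp. `rI + ε < RΘ`
(collision) of `K`, hence partnered, and its shell label IS `Φ (Θ ·)` (`moatLab`, `σ`-separation).  0 sorry.
-/

noncomputable section
open scoped BigOperators Classical InnerProductSpace RealInnerProductSpace
open MeasureTheory Set Metric Filter Topology
open Summit.AtomisticToContinuum.Crystallization.Theorems.ChartedPlanarOrderRigidityDoor (E3 IsClean IsCharted)
open Summit.AtomisticToContinuum.Crystallization.Theorems.ChartedPlanarOrderDensityDichotomy (μS IsSep)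
open Summit.AtomisticToContinuum.Crystallization.Theorems.ChartedPlanarOrderCleanScaleP (IsCleanP IsDoorSetP)
open Summit.AtomisticToContinuum.Crystallization.Theorems.ChartedPlanarOrderMesoCut (LayeredHom EnvClose)

namespace Summit.AtomisticToContinuum.Crystallization.Theorems.ChartedZeroExcessLayeredLatticeLiouville

/-! ### ZZP-1  Small facts: separated sites, the in-sheet lattice line -/

/-- two sites of a `σ`-separated set closer than `σ` coincide. [formal bookkeeping] -/
theorem eq_of_dist_lt_isSep {σ : ℝ} {C : Set E3} (h : IsSep σ C) {c c' : E3} (hc : c ∈ C) (hc' : c' ∈ C) (hd : dist c c' < σ) :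
    c = c' := by
  by_contra hne
  exact absurd (h c hc c' hc' hne) (not_le.2 hd)

/-- the in-sheet lattice line through `x` in the direction `loDir 0 = (1, 0)`. [this file, g81] -/
def sheetLine (x : ℤ × ℤ × ℤ) (n : ℕ) : ℤ × ℤ × ℤ := (x.1, (x.2.1 + n, x.2.2))

/-- the line starts at `x`. [formal bookkeeping] -/
theorem sheetLine_zero (x : ℤ × ℤ × ℤ) : sheetLine x 0 = x := by
  simp [sheetLine]

/-- the line does not return. [formal bookkeeping] -/
theorem sheetLine_injective (x : ℤ × ℤ × ℤ) : Function.Injective (sheetLine x) := by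
  intro n m h
  have h' := congrArg (fun y : ℤ × ℤ × ℤ => y.2.1) h
  simp only [sheetLine] at h'
  omega

/-- consecutive sites of the line are Barlow neighbours (in-sheet). [formal bookkeeping] -/
theorem barlowAdj_sheetLine_succ (τ : ℤ → Bool) (x : ℤ × ℤ × ℤ) (n : ℕ) : BarlowAdj τ (sheetLine x n) (sheetLine x (n + 1)) := by
  refine Or.inl ⟨rfl, 0, ?_⟩
  have h0 : loDir 0 = (1, 0) := rfl
  show ((x.2.1 + ((n + 1 : ℕ) : ℤ), x.2.2) : ℤ × ℤ) = (x.2.1 + (n : ℤ), x.2.2) + loDir 0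
  rw [h0, Prod.mk_add_mk]
  exact Prod.ext (by push_cast; ring) (by simp)

/-! ### ZZP-2  ★★★ The Θ-junction, pointwise -/

/-- ★★★ **THE Θ-JUNCTION, POINTWISE: (GL) ⟸ X_Θ ∧ LEMMA C.**  See the module docstring for the setting, the dials and the proof.  Binders, in order: the
door set and `ε` (tree ZF `shell_bondLabel`'s), the cool shadow crystal `hcr` and `2ε < σ`, the four dial inequalities, the global S-chart `hΨ` with
`hsurj`, the FINITENESS SOURCE `hfin`, LEMMA C's chart `hΦ` with its link-closure `hlc` within `Rl` of `K`, and X_Θ: `hinj`, `hiso` (forward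
direction, first argument in a `Kread` sheet), `hpart` (partnered collar within `RΘ`), `hK` (inner sites lie in `Kread` sheets). [this file, g81] -/
theorem exists_isBondLabel_of_slabIso {aHi δ σ ϑr Rs ε r rI ℓ RΘ Rl : ℝ} {S K H : Set E3}
    {L' : E3 →L[ℝ] E3} {w' : ℤ → E3} {U : E3 ≃ₗᵢ[ℝ] E3} {t : E3}
    (haHi : aHi ≤ 1) (hS : IsDoorSetP aHi δ S) (hε₀ : 0 ≤ ε) (hε : ε ≤ 1 / 40)
    (hcr : IsCoolShadowCrystal σ ϑr Rs ε r rI ℓ S K H L' w' U t) (hσ : 2 * ε < σ)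
    (hrI : r + 28 / 25 + ε ≤ rI) (hRΘ : rI + 28 / 25 + ε < RΘ) (hRΘℓ : RΘ ≤ ℓ) (hRl : rI < Rl)
    {Ψ : ℤ × ℤ × ℤ → E3} {τS : ℤ → Bool} (hΨ : IsBarlowBondChart S Set.univ Ψ τS) (hsurj : ∀ p ∈ S, ∃ x, Ψ x = p)
    (hfin : Set.Finite {x : ℤ × ℤ × ℤ | ∃ k ∈ K, dist (Ψ x) k ≤ r})
    {Φ : ℤ × ℤ × ℤ → E3} {τC : ℤ → Bool} {D : Set (ℤ × ℤ × ℤ)}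
    (hΦ : IsBarlowBondChart (placedCrystal L' w' U t) D Φ τC)
    (hlc : ∀ y ∈ D, (∃ k ∈ K, dist (Φ y) k < Rl) → ∀ y' : ℤ × ℤ × ℤ, BarlowAdj τC y y' → y' ∈ D)
    {Θ : ℤ × ℤ × ℤ → ℤ × ℤ × ℤ} {Kread : Set ℤ} (hinj : Function.Injective Θ)
    (hiso : ∀ x x' : ℤ × ℤ × ℤ, x.1 ∈ Kread → BarlowAdj τS x x' → BarlowAdj τC (Θ x) (Θ x'))
    (hpart : ∀ y : ℤ × ℤ × ℤ, Ψ y ∈ moatIn S K r ℓ → (∃ k ∈ K, dist (Ψ y) k < RΘ) → Θ y ∈ D ∧ dist (Ψ y) (Φ (Θ y)) ≤ ε)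
    (hK : ∀ x : ℤ × ℤ × ℤ, (∃ k ∈ K, dist (Ψ x) k ≤ r) → x.1 ∈ Kread) :
    ∃ lab : E3 → E3, IsBondLabel ε r ℓ S K (placedCrystal L' w' U t) lab := by
  obtain ⟨lab₀, hl₁, hl₂, hl₃, hl₄⟩ := shell_bondLabel haHi hS hε hcr
  set C : Set E3 := placedCrystal L' w' U t with hC
  have hsepC : IsSep σ C := isSep_placedCrystal U t hcr.2.1
  have hregin := hcr.2.2.2.2
  have hCeq : ∀ c ∈ C, ∀ c' ∈ C, dist c c' < σ → c = c' := fun c hc c' hc' hd => eq_of_dist_lt_isSep hsepC hc hc' hd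
  have hexS : ∀ x y, IsBond (Ψ x) (Ψ y) ↔ BarlowAdj τS x y := fun x y => hΨ.2.2 x (Set.mem_univ _) y (Set.mem_univ _)
  have hΨS : ∀ x, Ψ x ∈ S := fun x => hΨ.2.1 (Set.mem_univ x)
  -- ★ DRIFT CONTROL, one step backward along a path: the inner end inherits `∈ D` and `d(·, K) ≤ rI` from the known end
  have step : ∀ y y' : ℤ × ℤ × ℤ, (∃ k ∈ K, dist (Ψ y) k ≤ r) → BarlowAdj τS y y' → Θ y' ∈ D →
      (∃ k ∈ K, dist (Φ (Θ y')) k ≤ rI) → Θ y ∈ D ∧ ∃ k ∈ K, dist (Φ (Θ y)) k ≤ rI := by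
    intro y y' hy hadj hy'D hk'
    obtain ⟨k, hk, hdk⟩ := hk'
    have hadjC : BarlowAdj τC (Θ y) (Θ y') := hiso y y' (hK y hy) hadj
    have hyD : Θ y ∈ D := hlc (Θ y') hy'D ⟨k, hk, by linarith⟩ (Θ y) (barlowAdj_symm hadjC)
    have hb : IsBond (Φ (Θ y)) (Φ (Θ y')) := (hΦ.2.2 (Θ y) hyD (Θ y') hy'D).2 hadjC
    have hcC : Φ (Θ y) ∈ C := hΦ.2.1 hyD
    have hck : dist (Φ (Θ y)) k ≤ rI + 28 / 25 := by
      have := dist_triangle (Φ (Θ y)) (Φ (Θ y')) k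
      linarith [hb.2]
    refine ⟨hyD, ?_⟩
    by_contra hfar
    push Not at hfar
    -- the REG-in band exclusion
    obtain ⟨p, hpS, hpc⟩ := hregin (Φ (Θ y)) hcC ⟨k, hk, by linarith⟩ hfar
    obtain ⟨y'', hy''⟩ := hsurj p hpS
    have hpk : dist p k ≤ ε + (rI + 28 / 25) := by
      have := dist_triangle p (Φ (Θ y)) k
      linarith
    have hmoat : Ψ y'' ∈ moatIn S K r ℓ := by
      rw [hy'']
      refine ⟨hpS, ⟨k, hk, by linarith⟩, fun k₁ hk₁ => ?_⟩
      have h1 := hfar k₁ hk₁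
      have := dist_triangle (Φ (Θ y)) p k₁
      rw [dist_comm (Φ (Θ y)) p] at this
      linarith
    obtain ⟨hy''D, hy''d⟩ := hpart y'' hmoat ⟨k, hk, by rw [hy'']; linarith⟩
    rw [hy''] at hy''d
    have heq : Φ (Θ y'') = Φ (Θ y) := hCeq _ (hΦ.2.1 hy''D) _ hcC (by
      have := dist_triangle (Φ (Θ y'')) p (Φ (Θ y))
      rw [dist_comm (Φ (Θ y'')) p] at this
      linarith)
    have hyy : y'' = y := hinj (hΦ.1 hy''D hyD heq)
    obtain ⟨k₀, hk₀, hd₀⟩ := hy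
    have hd₀' : dist p k₀ ≤ r := by rw [← hy'', hyy]; exact hd₀
    have h1 := hfar k₀ hk₀
    have := dist_triangle (Φ (Θ y)) p k₀
    rw [dist_comm (Φ (Θ y)) p] at this
    linarith
  -- ★ the base of the walk: a non-inner neighbour of an inner site is a partnered moat site with label within `rI` of `K`
  have base : ∀ y y' : ℤ × ℤ × ℤ, (∃ k ∈ K, dist (Ψ y) k ≤ r) → BarlowAdj τS y y' → (∀ k ∈ K, r < dist (Ψ y') k) →
      Θ y' ∈ D ∧ ∃ k ∈ K, dist (Φ (Θ y')) k ≤ rI := by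
    intro y y' hy hadj hfar
    obtain ⟨k, hk, hdk⟩ := hy
    have hb : IsBond (Ψ y) (Ψ y') := (hexS y y').2 hadj
    have hd' : dist (Ψ y') k ≤ r + 28 / 25 := by
      have := dist_triangle (Ψ y') (Ψ y) k
      rw [dist_comm (Ψ y') (Ψ y)] at this
      linarith [hb.2]
    have hmoat : Ψ y' ∈ moatIn S K r ℓ := ⟨hΨS y', ⟨k, hk, by linarith⟩, hfar⟩
    obtain ⟨hD, hd⟩ := hpart y' hmoat ⟨k, hk, by linarith⟩
    refine ⟨hD, k, hk, ?_⟩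
    have := dist_triangle (Φ (Θ y')) (Ψ y') k
    rw [dist_comm (Φ (Θ y')) (Ψ y')] at this
    linarith
  -- ★ DRIFT CONTROL: every inner site has its Θ-value charted, with atom within `rI` of `K` (walk the sheet line out, then back)
  have innerQ : ∀ x : ℤ × ℤ × ℤ, (∃ k ∈ K, dist (Ψ x) k ≤ r) → Θ x ∈ D ∧ ∃ k ∈ K, dist (Φ (Θ x)) k ≤ rI := by
    intro x hx
    have hex : ∃ n : ℕ, sheetLine x n ∉ {x : ℤ × ℤ × ℤ | ∃ k ∈ K, dist (Ψ x) k ≤ r} := by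
      by_contra h
      push Not at h
      exact Set.infinite_of_injective_forall_mem (sheetLine_injective x) h hfin
    obtain ⟨n₀, hn₀, hlt⟩ : ∃ n₀ : ℕ, sheetLine x n₀ ∉ {x : ℤ × ℤ × ℤ | ∃ k ∈ K, dist (Ψ x) k ≤ r} ∧
        ∀ j < n₀, sheetLine x j ∈ {x : ℤ × ℤ × ℤ | ∃ k ∈ K, dist (Ψ x) k ≤ r} :=
      ⟨Nat.find hex, Nat.find_spec hex, fun j hj => not_not.1 (Nat.find_min hex hj)⟩
    have hpos : 0 < n₀ := by
      rcases Nat.eq_zero_or_pos n₀ with h | h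
      · exfalso
        apply hn₀
        rw [h, sheetLine_zero]
        exact hx
      · exact h
    have hind : ∀ i : ℕ, i ≤ n₀ →
        Θ (sheetLine x (n₀ - i)) ∈ D ∧ ∃ k ∈ K, dist (Φ (Θ (sheetLine x (n₀ - i)))) k ≤ rI := by
      intro i
      induction i with
      | zero =>
        intro _
        obtain ⟨m, hm⟩ : ∃ m, n₀ = m + 1 := ⟨n₀ - 1, by omega⟩
        have hI : ∃ k ∈ K, dist (Ψ (sheetLine x m)) k ≤ r := hlt m (by omega)
        have hfar : ∀ k ∈ K, r < dist (Ψ (sheetLine x n₀)) k := by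
          intro k hk
          by_contra hle
          push Not at hle
          exact hn₀ ⟨k, hk, hle⟩
        have hadj : BarlowAdj τS (sheetLine x m) (sheetLine x n₀) := by
          rw [hm]; exact barlowAdj_sheetLine_succ τS x m
        rw [Nat.sub_zero]
        exact base _ _ hI hadj hfar
      | succ i ih =>
        intro hi
        have hI : ∃ k ∈ K, dist (Ψ (sheetLine x (n₀ - (i + 1)))) k ≤ r := hlt _ (by omega)
        obtain ⟨hD, hk⟩ := ih (by omega)
        have hadj : BarlowAdj τS (sheetLine x (n₀ - (i + 1))) (sheetLine x (n₀ - i)) := by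
          have e : n₀ - i = n₀ - (i + 1) + 1 := by omega
          rw [e]; exact barlowAdj_sheetLine_succ τS x _
        exact step _ _ hI hadj hD hk
    have h := hind n₀ le_rfl
    rwa [Nat.sub_self, sheetLine_zero] at h
  -- coordinates of atoms; inner atoms are inner sites
  have hcrdex : ∀ p : E3, ∃ x : ℤ × ℤ × ℤ, p ∈ S → Ψ x = p := by
    intro p
    by_cases hp : p ∈ S
    · obtain ⟨x, hx⟩ := hsurj p hp
      exact ⟨x, fun _ => hx⟩
    · exact ⟨(0, 0, 0), fun h => absurd h hp⟩
  choose crd hcrd using hcrdex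
  have hcore : ∀ p ∈ S, (∃ k ∈ K, dist p k < ℓ) → p ∉ moatIn S K r ℓ → ∃ k ∈ K, dist (Ψ (crd p)) k ≤ r := by
    intro p hp hz hm
    rw [hcrd p hp]
    by_contra hc
    push Not at hc
    exact hm ⟨hp, hz, hc⟩
  -- ★ a partnered moat atom's shell label IS its Θ-label (σ-separation of C)
  have moatLab : ∀ p' : E3, p' ∈ moatIn S K r ℓ → (∃ k ∈ K, dist p' k < RΘ) →
      Θ (crd p') ∈ D ∧ Φ (Θ (crd p')) = lab₀ p' := by
    intro p' hm hnear
    have hp'S : p' ∈ S := hm.1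
    have hm' : Ψ (crd p') ∈ moatIn S K r ℓ := by rw [hcrd p' hp'S]; exact hm
    obtain ⟨hD, hd⟩ := hpart (crd p') hm' (by rw [hcrd p' hp'S]; exact hnear)
    rw [hcrd p' hp'S] at hd
    have h0C : lab₀ p' ∈ C := hl₁ p' ⟨hp'S, hm.2.2⟩ hm.2.1
    have h0d : dist p' (lab₀ p') ≤ ε := hl₄ p' ⟨hp'S, hm.2.2⟩ hm.2.1 hm.2.2
    refine ⟨hD, hCeq _ (hΦ.2.1 hD) _ h0C ?_⟩
    have := dist_triangle (Φ (Θ (crd p'))) p' (lab₀ p')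
    rw [dist_comm (Φ (Θ (crd p'))) p'] at this
    linarith
  -- inner–moat bonds and collisions
  have bondIC : ∀ p ∈ S, (∃ k ∈ K, dist p k < ℓ) → p ∉ moatIn S K r ℓ → ∀ p' : E3, p' ∈ moatIn S K r ℓ → IsBond p p' →
      IsBond (Φ (Θ (crd p))) (lab₀ p') := by
    intro p hp hz hm p' hm' hb
    have hx := hcore p hp hz hm
    have hxD := (innerQ _ hx).1
    have hp'S : p' ∈ S := hm'.1
    obtain ⟨k, hk, hdk⟩ := hcore p hp hz hm
    rw [hcrd p hp] at hdk
    have hnear : ∃ k ∈ K, dist p' k < RΘ := ⟨k, hk, by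
      have := dist_triangle p' p k
      rw [dist_comm p' p] at this
      linarith [hb.2]⟩
    obtain ⟨hx'D, hlab⟩ := moatLab p' hm' hnear
    have hadj : BarlowAdj τS (crd p) (crd p') := (hexS _ _).1 (by rw [hcrd p hp, hcrd p' hp'S]; exact hb)
    rw [← hlab]
    exact (hΦ.2.2 _ hxD _ hx'D).2 (hiso _ _ (hK _ hx) hadj)
  have collIC : ∀ p ∈ S, (∃ k ∈ K, dist p k < ℓ) → p ∉ moatIn S K r ℓ → ∀ p' : E3, p' ∈ moatIn S K r ℓ →
      Φ (Θ (crd p)) = lab₀ p' → p = p' := by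
    intro p hp hz hm p' hm' h
    have hx := hcore p hp hz hm
    obtain ⟨hxD, k, hk, hdk⟩ := innerQ _ hx
    have hp'S : p' ∈ S := hm'.1
    have h0d : dist p' (Φ (Θ (crd p))) ≤ ε := by rw [h]; exact hl₄ p' ⟨hp'S, hm'.2.2⟩ hm'.2.1 hm'.2.2
    have hnear : ∃ k ∈ K, dist p' k < RΘ := ⟨k, hk, by
      have := dist_triangle p' (Φ (Θ (crd p))) k
      linarith⟩
    obtain ⟨hx'D, hlab⟩ := moatLab p' hm' hnear
    have e1 : Θ (crd p) = Θ (crd p') := hΦ.1 hxD hx'D (by rw [h, hlab])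
    have e2 : crd p = crd p' := hinj e1
    rw [← hcrd p hp, ← hcrd p' hp'S, e2]
  -- ★ the label
  set lab : E3 → E3 := fun p => if p ∈ moatIn S K r ℓ then lab₀ p else Φ (Θ (crd p)) with hlab
  have labC : ∀ p, p ∈ moatIn S K r ℓ → lab p = lab₀ p := fun p h => if_pos h
  have labI : ∀ p, p ∉ moatIn S K r ℓ → lab p = Φ (Θ (crd p)) := fun p h => if_neg h
  refine ⟨lab, ?_, ?_, ?_, ?_⟩
  · -- (i) values in C
    intro p hp hz
    by_cases hm : p ∈ moatIn S K r ℓ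
    · rw [labC p hm]; exact hl₁ p ⟨hp, hm.2.2⟩ hz
    · rw [labI p hm]; exact hΦ.2.1 (innerQ _ (hcore p hp hz hm)).1
  · -- (ii) bonds go to bonds
    intro p hp p' hp' hz hz' hb
    by_cases hm : p ∈ moatIn S K r ℓ <;> by_cases hm' : p' ∈ moatIn S K r ℓ
    · rw [labC p hm, labC p' hm']; exact hl₂ p ⟨hp, hm.2.2⟩ p' ⟨hp', hm'.2.2⟩ hz hz' hb
    · rw [labC p hm, labI p' hm']; exact (bondIC p' hp' hz' hm' p hm hb.symm).symm
    · rw [labI p hm, labC p' hm']; exact bondIC p hp hz hm p' hm' hb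
    · rw [labI p hm, labI p' hm']
      have hx := hcore p hp hz hm
      have hx' := hcore p' hp' hz' hm'
      have hadj : BarlowAdj τS (crd p) (crd p') := (hexS _ _).1 (by rw [hcrd p hp, hcrd p' hp']; exact hb)
      exact (hΦ.2.2 _ (innerQ _ hx).1 _ (innerQ _ hx').1).2 (hiso _ _ (hK _ hx) hadj)
  · -- (iii) injectivity on the zone
    rintro p ⟨hp, hz⟩ p' ⟨hp', hz'⟩ h
    by_cases hm : p ∈ moatIn S K r ℓ <;> by_cases hm' : p' ∈ moatIn S K r ℓ
    · rw [labC p hm, labC p' hm'] at h; exact hl₃ ⟨⟨hp, hm.2.2⟩, hz⟩ ⟨⟨hp', hm'.2.2⟩, hz'⟩ h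
    · rw [labC p hm, labI p' hm'] at h; exact (collIC p' hp' hz' hm' p hm h.symm).symm
    · rw [labI p hm, labC p' hm'] at h; exact collIC p hp hz hm p' hm' h
    · rw [labI p hm, labI p' hm'] at h
      have e := hinj (hΦ.1 (innerQ _ (hcore p hp hz hm)).1 (innerQ _ (hcore p' hp' hz' hm')).1 h)
      rw [← hcrd p hp, ← hcrd p' hp', e]
  · -- (iv) the cool atoms move by at most ε
    intro p hp hz hc
    rw [labC p ⟨hp, hz, hc⟩]
    exact hl₄ p ⟨hp, hc⟩ hz hc

/-! ### ZZP-3  ★★★ The record instance, with X_Θ's clauses verbatim -/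

/-- ★★★ **THE Θ-JUNCTION AT THE (GL) RECORD DIALS** `(σ, ϑr, Rs, ε, r, rI, ℓ) = (17/20, 10⁻⁴, 5, 10⁻⁴, 8, 10, 43/2)` (the `IsCoolShadowCrystal` binder of
`BondLabelP ϑc (1/10) 8 4 12 16 (17/20) (1/10000) 5 (1/10000) 10 (43/2) 1 2 (1/16) (1/50)`), partnered collar radius `RΘ = 19.3`: X_Θ's three clauses
VERBATIM (PLAN l.7458: `hX₁` Injective Θ · `hX₂` the iso clause on `Kread` sheets, BOTH directions as stated there — only the forward one is used here ·
`hX₃` the partnered collar `d(Ψ y, K) < 19.3`) + LEMMA C's chart (`hΦ`) with link-closure beyond `10` of `K` (`hRl`, `hlc`) + the S-chart, the finiteness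
source and `hK` ⟹ a bond label `IsBondLabel (1/10000) 8 (43/2) S K C lab`.  All numeric side conditions by `norm_num`. [this file, g81] -/
theorem exists_isBondLabel_of_slabIso_record {aHi δ Rl : ℝ} {S K H : Set E3}
    {L' : E3 →L[ℝ] E3} {w' : ℤ → E3} {U : E3 ≃ₗᵢ[ℝ] E3} {t : E3}
    (haHi : aHi ≤ 1) (hS : IsDoorSetP aHi δ S)
    (hcr : IsCoolShadowCrystal (17 / 20) (1 / 10000) 5 (1 / 10000) 8 10 (43 / 2) S K H L' w' U t)
    {Ψ : ℤ × ℤ × ℤ → E3} {τS : ℤ → Bool} (hΨ : IsBarlowBondChart S Set.univ Ψ τS) (hsurj : ∀ p ∈ S, ∃ x, Ψ x = p)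
    (hfin : Set.Finite {x : ℤ × ℤ × ℤ | ∃ k ∈ K, dist (Ψ x) k ≤ 8})
    {Φ : ℤ × ℤ × ℤ → E3} {τC : ℤ → Bool} {D : Set (ℤ × ℤ × ℤ)}
    (hΦ : IsBarlowBondChart (placedCrystal L' w' U t) D Φ τC) (hRl : 10 < Rl)
    (hlc : ∀ y ∈ D, (∃ k ∈ K, dist (Φ y) k < Rl) → ∀ y' : ℤ × ℤ × ℤ, BarlowAdj τC y y' → y' ∈ D)
    {Θ : ℤ × ℤ × ℤ → ℤ × ℤ × ℤ} {Kread : Set ℤ} (hK : ∀ x : ℤ × ℤ × ℤ, (∃ k ∈ K, dist (Ψ x) k ≤ 8) → x.1 ∈ Kread)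
    (hX₁ : Function.Injective Θ)
    (hX₂ : ∀ x x' : ℤ × ℤ × ℤ, x.1 ∈ Kread → (BarlowAdj τS x x' ↔ BarlowAdj τC (Θ x) (Θ x')))
    (hX₃ : ∀ y : ℤ × ℤ × ℤ, Ψ y ∈ moatIn S K 8 (43 / 2) → (∃ k ∈ K, dist (Ψ y) k < 193 / 10) →
      Θ y ∈ D ∧ dist (Ψ y) (Φ (Θ y)) ≤ 1 / 10000) :
    ∃ lab : E3 → E3, IsBondLabel (1 / 10000) 8 (43 / 2) S K (placedCrystal L' w' U t) lab :=
  exists_isBondLabel_of_slabIso (RΘ := 193 / 10) haHi hS (by norm_num) (by norm_num) hcr (by norm_num) (by norm_num) (by norm_num)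
    (by norm_num) hRl hΨ hsurj hfin hΦ hlc hX₁ (fun x x' hx h => (hX₂ x x' hx).1 h) hX₃ hK

end Summit.AtomisticToContinuum.Crystallization.Theorems.ChartedZeroExcessLayeredLatticeLiouville
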